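import Summits.Ventures.WeilGRH.UniformConductorFloorLog12TableValid
import Summits.Ventures.WeilGRH.UniformConductorFloorLog12Table256Valid1
import Summits.Ventures.WeilGRH.UniformConductorFloorLog12Table256Valid2
import Summits.Ventures.WeilGRH.UniformConductorFloorLog12Table256Valid3
import Summits.Ventures.WeilGRH.UniformConductorFloorLog12Table256Valid4
import Summits.Ventures.WeilGRH.UniformConductorFloorLog12Table256Valid5
import Summits.Ventures.WeilGRH.UniformConductorFloorLog12Table256Valid6
import Summits.Ventures.WeilGRH.UniformConductorFloorLog12Table256Valid7
import Mathlib.Data.List.GetD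
import HarnessLib

/-!
# GRH arm (rh-explicit, venture WeilGRH): the 256-mode special-value table at `a = (log 12)/2` — `tab256_valid : TabValid (2^80) a ks 256 tab256`

Cell `rh-explicit`, WEIL TRACK — GRH ARM (weil-grh-1, gen10).  Glue: the low modes `0 … 127` of `tab256 = tabOfPacked 104 8 (tabP ++ tabPHi)` ARE the
tree table `tab` (`tab256 = tab ++ tabOfPacked 104 8 tabPHi` by `List.map_append`, so `tget tab256 n = tget tab n` for `n < 128`) and inherit
`Log12Table.tab_valid` (`UniformConductorFloorLog12TableValid.lean`); the high modes `128 … 255` are the seven kernel slices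
`UniformConductorFloorLog12Table256Valid1…7.lean`, chained by `TabValid.extend`.  Consumer: the door-E cell for `χ₀` mod `281`
(`UniformConductorFloorPrincipalMod281Log12*.lean`, far block `B₃ = 255`).  No kernel computation beyond two list-length facts; no definitions;
standard axioms. [cite: Moore1966, Ch. 3 (interval arithmetic: inclusion property)]
-/

namespace Summit.Ventures.WeilGRH.Log12Table
open Literature.NumberTheory.LFunctions Literature.NumberTheory.LFunctions.Yoshida1992 Encl Literature.Analysis.ValidatedNumerics.NumericsMP

/-- `tab256` is the tree table followed by the unpacked high rows. [folklore] -/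
theorem tab256_eq : tab256 = tab ++ tabOfPacked 104 8 tabPHi := by
  simp only [tab256, tab, tabOfPacked, List.map_append]

/-- The packed low table has `128` rows. [folklore] -/
theorem tabP_length : tabP.length = 128 := by
  set_option maxRecDepth 20000 in decide +kernel

/-- The tree table has `128` records. [folklore] -/
theorem tab_length : tab.length = 128 := by
  simp only [tab, tabOfPacked, List.length_map, tabP_length]

/-- Below `128` the 256-mode table reads the tree table. [folklore] -/
theorem tget_tab256_of_lt {n : ℕ} (hn : n < 128) : tget tab256 n = tget tab n := by
  rw [tab256_eq]
  unfold tget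
  exact List.getD_append _ _ _ _ (by rw [tab_length]; exact hn)

/-- ★ The 256-mode `(log 12)/2` special-value table is valid below `256`. [cite: Moore1966, Ch. 3 (interval arithmetic: inclusion property)] -/
theorem tab256_valid : TabValid (2 ^ 80) a ks 256 tab256 := by
  have h128 : TabValid (2 ^ 80) a ks 128 tab256 := fun n hn ↦ by
    rw [tget_tab256_of_lt hn]; exact tab_valid n hn
  have h148 : TabValid (2 ^ 80) a ks (128 + 20) tab256 :=
    h128.extend fun n hn hnk ↦ idxValid_of_checkTable (prm := prm) (by norm_num [prm]) a_pos consts_valid tH128 hn hnk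
  have h168 : TabValid (2 ^ 80) a ks (148 + 20) tab256 :=
    h148.extend fun n hn hnk ↦ idxValid_of_checkTable (prm := prm) (by norm_num [prm]) a_pos consts_valid tH148 hn hnk
  have h188 : TabValid (2 ^ 80) a ks (168 + 20) tab256 :=
    h168.extend fun n hn hnk ↦ idxValid_of_checkTable (prm := prm) (by norm_num [prm]) a_pos consts_valid tH168 hn hnk
  have h208 : TabValid (2 ^ 80) a ks (188 + 20) tab256 :=
    h188.extend fun n hn hnk ↦ idxValid_of_checkTable (prm := prm) (by norm_num [prm]) a_pos consts_valid tH188 hn hnk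
  have h228 : TabValid (2 ^ 80) a ks (208 + 20) tab256 :=
    h208.extend fun n hn hnk ↦ idxValid_of_checkTable (prm := prm) (by norm_num [prm]) a_pos consts_valid tH208 hn hnk
  have h248 : TabValid (2 ^ 80) a ks (228 + 20) tab256 :=
    h228.extend fun n hn hnk ↦ idxValid_of_checkTable (prm := prm) (by norm_num [prm]) a_pos consts_valid tH228 hn hnk
  have h256 : TabValid (2 ^ 80) a ks (248 + 8) tab256 :=
    h248.extend fun n hn hnk ↦ idxValid_of_checkTable (prm := prm) (by norm_num [prm]) a_pos consts_valid tH248 hn hnk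
  exact h256

end Summit.Ventures.WeilGRH.Log12Table
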